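import Summits.QuantumFields.YangMills.Theorems.BalabanUVNodesN16WitnessDialOfRecordEdges
import Literature.MathematicalPhysics.QuantumFieldTheory.Balaban1983to89.B11Thm1Exact

/-!
# Route «BalabanUVNodes», crux K3ᴬ `SpineGivenEndpointR13SepCoPHVAx` (stmt-QuantumFields-27247), node N16 = NE3, located seam S-N16-1 (director-ym №572 (4)) — THE
# INSTANCE-LEVEL REPAIR C′ OF LEAF-06's TORUS CARRIER: `torusVPCls` = `MinimalActionDictionary.torusVP` with its cube family CUT TO PRINT's SIZE CLASS `1 ≤ M`
# ([Balaban1985Variational] p. 279 L1–5: «□ has a size 2ML^jη, where M is a multiple of R₁M₁»), so that [Balaban1985Variational] THEOREM 1 READ AT B11's OWN ([Balaban1985Averaging]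
# (42)) AVERAGING — `B11Thm1.Thm1At C (torusVPCls …)` ∕ `B11Thm1Exact.Thm1PrintedExact R₁M₁ (fun k => torusVPCls … (k+1))` — gives node N16's slot key (T9ˢ) ∧ (T8) BY ONE
# APPLICATION (dag-n16-w1 file 9's `reg910Slot_of_reg910_one_le`, typed ahead for exactly this), and node N16's K3ᴬ v8 sentence `WitnessDialN16Free N β` displays node N05's
# Σ-text + THEOREM 1 AS PRINTED at that carrier — NO (0.4)→(42) transfer, NO node-N07 record slot

Cell `pub-ymgap`, seat `pub-ymgap-dag-n16-e` (R134 acceleration seat (a), strategy s2; HUMAN RULING D-0062; chair R424 venue), generation 32, module 68 (v1.1 = v1 + §5, append-only: the ceiling letter `R₁M₁` PER FAMILY — referee ref-B READ-1081 row (ε); 1 `def` — a VARIANT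
of leaf-06's dictionary object with a smaller cube type, no new mathematics — + theorems; 0 `sorry`, standard axioms; Theses-free).  `--kind definition --supports
stmt-QuantumFields-27247 --as helper` (count-neutral; proves NO registered stub).  `bears_on: R4∕N16 · seam S-N16-1 · edge N07 → N16`.  Over module 67 (✓p823028), 63 (✓p811120),
65 (✓p812347), dag-n16-w1 files 3 ∕ 9 (`lipGauge`; `reg910Slot_of_reg910_one_le`, `two_le_cubeM_slot` ✓p609800), leaf-06's `MinimalActionDictionary` (`torusVP`, `cubeM`,
`gaugeFactors`, `gaugeInf`, `cubeM_slot_le`) and r2's `B11Thm1` ∕ `B11Thm1Exact` (`Thm1At`, `Thm1PrintedExact`) — CITED BY NAME, none edited.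

WHY (the seam, first-hand).  Director-ym №572 (2026-08-31) booked N16's N07-side in-edge as the LOCATED PRINT SEAM S-N16-1 = dag-n16-w1's transfer `Thm1AtTransfer04toSlot F N ζ B₀`
(«Thm 1 at NODE 00's (0.4)-objects → the slot key at leaf-06's (42)-problem»; [Balaban1987RG1] p. 253 universality remark; nobody's theorem).  Modulo node N07's slot that
transfer is EQUIVALENT to the slot key itself (module 67's ledger memo §3), and the slot key is [Balaban1985Variational] Theorem 1 (8)–(10) READ AT B11's OWN averaging — B11
p. 277 recalls its definitions from [4] = [Balaban1985Averaging], whose average is (42) p. 23 = the tree's `B7Prop1Explicit.bavg` ∕ `B7Prop2Explicit.avgIter` (dag-n16-w3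
`…N16AveragingPin`: «for THEOREM 1 OF B11 the tree's constraint IS print's»).  What stood in the way of displaying Theorem 1 DIRECTLY at leaf-06's torus carrier was ONE dictionary
divergence, D-s3-3: `torusVP` takes `Cube := Site d × ℕ` (ALL lattice cubes, `sizeM = (2K+1)∕(2L^k)` down to `5∕(2L^k) → 0`), and dag-n16-w2's `not_forall_thm1At_torusVP`
(✓`…N16Thm1AtTorusVPSmallCubes`) refutes `∀ k, Thm1At C (torusVP …)` at rank two THROUGH THOSE SMALL CUBES ONLY («the witness uses the cube size M = 5∕(2L^j) < 1; it MISSES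
the repaired reading C′ = (9)–(10) on print's cube class only … or `Reg910` restricted to `1 ≤ sizeM c`; N16's consumers use the single cube K = L^{k+1} − 1 + L^{k+1} + 2
(`cubeM_slot_le : M ≤ 7∕2`), so their proofs transfer to C′ by name once it is declared»).  THIS FILE DECLARES C′ (§1) and transfers them (§2–§4).

CONTENTS.  §1 `torusVPCls d L N G k : B11.VarProblem` — `torusVP d L N G k` field for field, EXCEPT `Cube := {c : Site d × ℕ // 1 ≤ cubeM L k c.2}` (and `sizeM ∕ Gauged ∕ norm*`
read through `c.1`); `Iff.rfl` ∕ `rfl` faces: `regularity_torusVPCls_iff` (r2's `Regularity` at a class cube IS `torusVP`'s at the underlying cube), `onMinimalOrbit_torusVPCls`,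
`reg7_torusVPCls`, `inU_torusVPCls`, `inB_torusVPCls`; `one_le_cubeM_slot` (the collar-slot cube IS a class cube).  §2 ★ `reg910_one_le_of_thm1At_torusVPCls` (Thm 1 at the class
carrier ⟹ file 9's `hR1` shape: `Reg910` on the cubes with `1 ≤ M ≤ M(ε₁)` of `torusVP`) · ★★ `reg910Slot_of_thm1At_torusVPCls` ((T9ˢ), given `M(e) ≥ 7∕2`) ·
`exists8Min_of_thm1At_torusVPCls` ((T8)) · ★★ `exists_consts_slotKey_of_thm1PrintedExact_torusVPCls` (from THEOREM 1 VERBATIM INCLUDING ITS LAST SENTENCE, r2's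
`Thm1PrintedExact R₁M₁` with `M(ε₁) = R₁M₁(a₁∕ε₁)`, at the class carriers `k ↦ torusVPCls … (k+1)`, and `7∕2 ≤ R₁M₁`: constants `C` with `M(e) ≥ 7∕2` ∧ (T9ˢ) ∧ (T8)).
§3 ★★ node N16: `witnessDialN16Free_of_n05UniformP_thm1At_torusVPCls` ∕ ★★★ `witnessDialN16Free_of_n05UniformP_thm1PrintedExact` (N16's ENTIRE K3ᴬ v8 stub-1 share from node N05's
Σ-text + THEOREM 1 AS PRINTED at the (42)-torus class carrier with `lipGauge`, per family) · ★★ `stub1Text_of_n05UniformP_thm1PrintedExact` (`N = 2`: the registered stub-1 text,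
65 §4 ∘ §3).  §4 the seam dissolved BY NAME: `thm1AtTransfer04toSlot_of_thm1At_torusVPCls` — Thm 1 at the class carrier (with `M(e) ≥ 7∕2`, `C.B₃ ≤ B₀`) PROVES dag-n16-w1's
transfer `Thm1AtTransfer04toSlot F N ζ B₀` for EVERY `ζ` (its consequent holds outright), so S-N16-1's displayed `Prop` is a COROLLARY of Theorem 1 at B11's own averaging.

HONEST FRAMING.  One dictionary VARIANT (a smaller cube type on leaf-06's object) + composition BY NAME; no estimate of Bałaban's proved.  `Thm1At C (torusVPCls …)` ∕
`Thm1PrintedExact R₁M₁ (fun k => torusVPCls … (k+1))` are HYPOTHESES — [Balaban1985Variational] Theorem 1 AS PRINTED, read through leaf-06's dictionary with its DECLARED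
divergences D-s3-1 (`InU` = plaquette-only class `sfClass` — located item A1), D-s3-2 (`OnMinimalOrbit` = global minimiser `IsMinimiser` — D-s3-2), D-s3-4∕5 (`holderA = 0`,
`UniqueCriticalOrbit = True`, WEAKER than print), and D-s3-3 REPAIRED HERE UP TO THE CLASS BOUNDARY (print: `M ∈ R₁M₁·ℕ⁺` on block-aligned cubes of EVEN side `2ML^j`; here: all
centred odd cubes with real `M ≥ 1` — print's (9)–(10) on the smallest class cube containing a given cube of size `M ≥ 1` give (9)–(10) on it with `B₃ ↦ B₃·max(2, R₁M₁)`, a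
constant absorbed by Theorem 1's `∃ B₃`; this absorption is ASSERTED BY THE DICTIONARY, not proved here).  NOT refuted: dag-n16-w2's witness needs `M < 1` (its header, «What this is
NOT»); dag-n16-w1's `…N16SlotKeyUnit` §2 shows (T8) forces `B₃ ≥ 1` — print's `B₃ ≥ 72d³L³B₀` ((162)).  `hN05` (node N05's Σ-text; N06's binders behind p681888) displayed as in
67.  NO stub of K3ᴬ v8 closed; N16 (TABLED under №572, not booked) ∕ N05 ∕ N06 ∕ N07 NOT discharged by this file; S-N16-1's status is the director's ∕ chair's to re-word, not
this file's; counts UNMOVED (typed 28∕28 · discharged 8∕27 · A 8∕28 · K3ᴬ 0∕2).  One finite four-torus at fixed `ε`, Bałaban AS PRINTED — NOT ℝ⁴, NOT infinite volume, NOT OS,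
NOT a mass gap; the YM mass gap (Clay) is NOT proved by any of this.  No `sorry` ∕ `instance` ∕ `notation`; standard axioms.
References: [Balaban1985Variational] T. Bałaban, CMP **102** (1985) 277–309: (1) p. 277, (2)–(8) p. 278, Thm 1 (8)–(10) p. 279 (L1–5: the cube class), Sect. F p. 300 («M ≥ R₁M₁ …
M = M′R₁M₁»); [Balaban1985Averaging] T. Bałaban, CMP **98** (1985) 17–51, (42) p. 23; [Balaban1985RegularSpaces] T. Bałaban, CMP **99** (1985) 75–102, Thm 4 p. 88, Prop. 3 p. 87;
[Balaban1987RG1] T. Bałaban, CMP **109** (1987) 249–301, p. 253.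
-/

set_option autoImplicit false

open scoped BigOperators Matrix Matrix.Norms.L2Operator
open NormedSpace

namespace Summit.QuantumFields.YangMills.BalabanUVNodes.N16SlotKeyOfThm1PrintClass

open Literature.MathematicalPhysics.QuantumFieldTheory.Balaban1983to89
open Literature.MathematicalPhysics.QuantumFieldTheory.Balaban1983to89.T4Continuum (T4Family ULoop)
open B7Prop1Explicit B7Prop2Explicit MatrixLog UnitaryModel
open T4AveragingDeficitWall hiding Site Plane Plaq Bond
open B8LeafModelZdHP2Per (zdGF3HP₂Per)
open Node00 (Stage13Params Stage13HParams IdxB8SubDPerκ NE3Letters₁₁ ne3ConstLayerOfRecord₁₁ ne3NperOfRecord₁₁ ne3DomOfRecord₁₁ MatA ZIdx ResidZ Z11OfRecord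
  exists_thm1At_of_b11Leaf_Z11OfRecord)
open Summit.QuantumFields.BalabanUV.T4Continuum
open MinimalActionSandwich (IsMinimiser)
open MinimalActionRate (sfClass)
open MinimalActionDictionary (torusVP RadiiMono cubeM gaugeFactors gaugeInf cubeM_slot_le)
open B11 (VarProblem Regularity)
open B11Thm1 (Thm1At Exists8 Unique6 Reg910)
open B11Thm1Exact (Thm1PrintedExact)
open DagBinding (B11Leaf)
open YMDAG.UVSplit (ne3OfRecord₁₁)
open Summit.QuantumFields.YangMills.BalabanUVNodes.N16HolderDefs (N16HolderAt)
open Summit.QuantumFields.YangMills.BalabanUVNodes.N16PinnedLayer13CoPH (N16LettersEnd eraseNE3Ax)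
open Summit.QuantumFields.YangMills.BalabanUVNodes.N16Stage3OfFamilyMat (stage3OfFamilyMat)
open Summit.QuantumFields.YangMills.BalabanUVNodes.N16WitnessDialFaceCmap (WitnessDialN16Free witnessDialN16Free_of_n05UniformP_reg910Slot)
open Summit.QuantumFields.YangMills.BalabanUVNodes.N16H7OfN07RecordSlot (lipGauge radiiMono_lipGauge' interface_lipGauge')
open Summit.QuantumFields.YangMills.BalabanUVNodes.N16H7OfN07RecordSlotKey (Thm1AtTransfer04toSlot)
open Summit.QuantumFields.YangMills.BalabanUVNodes.N16H7LooseOfReg910Slot (reg910Slot_of_reg910_one_le two_le_cubeM_slot)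
open Summit.QuantumFields.YangMills.BalabanUVNodes.N16Stub1ShareK3AxV8 (stub1Text_of_witnessFree)
open Summit.QuantumFields.YangMills.Theorems.K3AxV8Defs (RateReading13AxP RunSel LetterReading rrOfRecord KeyedRatesHolderD4V GuardedReading GuardedReadingN16)

noncomputable section

/-! ## §1 Leaf-06's torus carrier with the cube family cut to print's size class `1 ≤ M` -/

section Carrier

variable {d : ℕ} {n : Type} [Fintype n] [DecidableEq n]

variable (d) in
/-- **THE TORUS INSTANCE OF r2's CARRIER `B11.VarProblem` AT LEVEL `k`, CUBES OF PRINT's SIZE CLASS ONLY** — leaf-06's `MinimalActionDictionary.torusVP d L N G k` field for field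
(`Cfg = Bdry =` configurations on `ℤ^d`; `InU e` = `sfClass d L N e k`; `InB V U` = «`avgIter L U k = V`» ((3) at [Balaban1985Averaging] (42)); `Reg7 e V` = «`V ∈ sfClass d L N e 0`»;
`OnMinimalOrbit e V U` = `IsMinimiser d (sfClass d L N e) L N k V U`; `scale = k`, `eta = L^{−k}`; regularity fields = `Ψ` = `gaugeInf G`, `Gauged` = `gaugeFactors G ≠ ∅`,
`holderA = 0`, `UniqueCriticalOrbit = True`), EXCEPT that the cube family is `{c : Site d × ℕ // 1 ≤ cubeM L k c.2}`: the centred lattice cubes `box K y` of size parameter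
`M = (2K+1)∕(2L^k) ≥ 1` — [Balaban1985Variational] p. 279 L1–5 («□ has a size 2ML^jη, where M is a multiple of R₁M₁», `R₁M₁ ≥ 1`) read as the real window `M ≥ 1` (divergence
D-s3-3 of leaf-06's header, REPAIRED up to the class boundary: dag-n16-w2's second form of C′).  A dictionary VARIANT; nothing of Bałaban asserted.
[cite: Balaban1985Variational, (2)–(8) p.278, Thm 1 (8)–(10) p.279] [folklore] -/
@[folklore]
def torusVPCls (L N : ℕ) (G : (Site d → Fin d → (Matrix n n ℂ)ˣ) → Site d → ℕ → ℝ → ℝ → ℝ → Prop) (k : ℕ) : VarProblem where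
  Cfg := Site d → Fin d → (Matrix n n ℂ)ˣ
  Bdry := Site d → Fin d → (Matrix n n ℂ)ˣ
  Cube := {c : Site d × ℕ // 1 ≤ cubeM L k c.2}
  scale := fun _ => k
  sizeM := fun c => cubeM L k c.1.2
  eta := ((L : ℝ) ^ k)⁻¹
  L := L
  InU := fun e U => U ∈ sfClass d L N e k
  InB := fun V U => avgIter L U k = V
  Reg7 := fun e V => V ∈ sfClass d L N e 0
  OnMinimalOrbit := fun e V U => IsMinimiser d (sfClass d L N e) L N k V U
  UniqueCriticalOrbit := fun _ _ _ => True
  Gauged := fun U c => (gaugeFactors G L k U c.1.1 c.1.2).Nonempty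
  normA := fun U c => gaugeInf G L k U c.1.1 c.1.2
  normGradA := fun U c => gaugeInf G L k U c.1.1 c.1.2
  holderA := fun _ _ _ => 0
  normLapA := fun U c => gaugeInf G L k U c.1.1 c.1.2

variable {L N : ℕ} {G : (Site d → Fin d → (Matrix n n ℂ)ˣ) → Site d → ℕ → ℝ → ℝ → ℝ → Prop} {k : ℕ}

/-- **r2's `Regularity` ((9) ∧ (10) in some gauge) AT A CLASS CUBE IS `torusVP`'s AT THE UNDERLYING CUBE** (`Iff.rfl`). [folklore] -/
theorem regularity_torusVPCls_iff (B₃ B₄ ε : ℝ) (U : Site d → Fin d → (Matrix n n ℂ)ˣ) (c : {c : Site d × ℕ // 1 ≤ cubeM L k c.2}) :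
    Regularity (torusVPCls d L N G k) B₃ B₄ ε U c ↔ Regularity (torusVP d L N G k) B₃ B₄ ε U c.1 :=
  Iff.rfl

/-- Face (`Iff.rfl`): the minimal-orbit predicate of the class carrier is leaf-06's `IsMinimiser`. [folklore] -/
theorem onMinimalOrbit_torusVPCls_iff (e : ℝ) (V U : Site d → Fin d → (Matrix n n ℂ)ˣ) :
    (torusVPCls d L N G k).OnMinimalOrbit e V U ↔ IsMinimiser d (sfClass d L N e) L N k V U :=
  Iff.rfl

/-- Face (`Iff.rfl`): hypothesis (7) of the class carrier is «`V ∈ sfClass d L N e 0`». [folklore] -/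
theorem reg7_torusVPCls_iff (e : ℝ) (V : Site d → Fin d → (Matrix n n ℂ)ˣ) : (torusVPCls d L N G k).Reg7 e V ↔ V ∈ sfClass d L N e 0 :=
  Iff.rfl

/-- Face (`Iff.rfl`): the class (2)∕(6)∕(8) of the class carrier is `sfClass d L N e k`. [folklore] -/
theorem inU_torusVPCls_iff (e : ℝ) (U : Site d → Fin d → (Matrix n n ℂ)ˣ) : (torusVPCls d L N G k).InU e U ↔ U ∈ sfClass d L N e k :=
  Iff.rfl

/-- Face (`Iff.rfl`): the constraint (3) of the class carrier is «`avgIter L U k = V`» ([Balaban1985Averaging] (42)∕(43)). [folklore] -/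
theorem inB_torusVPCls_iff (V U : Site d → Fin d → (Matrix n n ℂ)ˣ) : (torusVPCls d L N G k).InB V U ↔ avgIter L U k = V :=
  Iff.rfl

/-- **THE COLLAR-SLOT CUBE IS A CLASS CUBE**: `1 ≤ cubeM L k (L^k − 1 + L^k + 2)` (indeed `≥ 2`, dag-n16-w1 `two_le_cubeM_slot`). [folklore] -/
theorem one_le_cubeM_slot (hL : 1 ≤ L) (k : ℕ) : 1 ≤ cubeM L k (L ^ k - 1 + L ^ k + 2) :=
  le_trans (by norm_num) (two_le_cubeM_slot hL k)

/-! ## §2 Theorem 1 at the class carrier ⟹ the slot key (T9ˢ) ∧ (T8) -/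

/-- **★ THEOREM 1 AT THE CLASS CARRIERS ⟹ `Reg910` ON THE CUBES WITH `1 ≤ M ≤ M(ε₁)` OF `torusVP`** — dag-n16-w1 file 9's `hR1` shape, by one projection per cube.
[cite: Balaban1985Variational, Thm 1 (9)–(10) p.279] [folklore] -/
theorem reg910_one_le_of_thm1At_torusVPCls (C : B11Thm1.Consts) (hT : ∀ k : ℕ, Thm1At C (torusVPCls d L N G (k + 1))) :
    ∀ (k : ℕ) (ε₁ : ℝ), 0 < ε₁ → ε₁ ≤ C.a₁ → ∀ (V U : Site d → Fin d → (Matrix n n ℂ)ˣ), V ∈ sfClass d L N ε₁ 0 →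
      IsMinimiser d (sfClass d L N (C.B₃ * ε₁)) L N (k + 1) V U →
        ∀ c : Site d × ℕ, 1 ≤ cubeM L (k + 1) c.2 → cubeM L (k + 1) c.2 ≤ C.Mfun ε₁ → Regularity (torusVP d L N G (k + 1)) C.B₃ C.B₄ ε₁ U c := by
  intro k ε₁ hε₁ hε₁a V U hV hU c h1 hM
  obtain ⟨-, -, h910⟩ := hT k ε₁ hε₁ hε₁a V hV
  exact (regularity_torusVPCls_iff C.B₃ C.B₄ ε₁ U ⟨c, h1⟩).1 (h910 U hU ⟨c, h1⟩ hM)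

/-- **★★ THE SLOT KEY (T9ˢ) FROM THEOREM 1 AT THE CLASS CARRIERS** (`M(e) ≥ 7∕2` on `0 < e ≤ a₁` — print: `M(ε₁) = R₁M₁(a₁∕ε₁) ≥ R₁M₁`): §2's `hR1` ∘ dag-n16-w1 file 9's
`reg910Slot_of_reg910_one_le` (the collar-slot cube has `2 ≤ M ≤ 7∕2`). [cite: Balaban1985Variational, Thm 1 (9)–(10) p.279] [folklore] -/
theorem reg910Slot_of_thm1At_torusVPCls (hL : 1 ≤ L) (C : B11Thm1.Consts) (hM : ∀ e : ℝ, 0 < e → e ≤ C.a₁ → 7 / 2 ≤ C.Mfun e)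
    (hT : ∀ k : ℕ, Thm1At C (torusVPCls d L N G (k + 1))) :
    ∀ (k : ℕ) (ε₁ : ℝ), 0 < ε₁ → ε₁ ≤ C.a₁ → ∀ (V U : Site d → Fin d → (Matrix n n ℂ)ˣ), V ∈ sfClass d L N ε₁ 0 →
      IsMinimiser d (sfClass d L N (C.B₃ * ε₁)) L N (k + 1) V U →
        ∀ x : Site d, Regularity (torusVP d L N G (k + 1)) C.B₃ C.B₄ ε₁ U (x, L ^ (k + 1) - 1 + L ^ (k + 1) + 2) :=
  reg910Slot_of_reg910_one_le hL C hM (reg910_one_le_of_thm1At_torusVPCls C hT)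

/-- **(T8) FROM THEOREM 1 AT THE CLASS CARRIERS**: the existence clause (8) in leaf-06's minimal-orbit form (`rfl`). [cite: Balaban1985Variational, Thm 1 (8) p.279] [folklore] -/
theorem exists8Min_of_thm1At_torusVPCls (C : B11Thm1.Consts) (hT : ∀ k : ℕ, Thm1At C (torusVPCls d L N G (k + 1))) :
    ∀ (k : ℕ) (ε₁ : ℝ), 0 < ε₁ → ε₁ ≤ C.a₁ → ∀ V : Site d → Fin d → (Matrix n n ℂ)ˣ, V ∈ sfClass d L N ε₁ 0 →
      ∃ U : Site d → Fin d → (Matrix n n ℂ)ˣ, IsMinimiser d (sfClass d L N (C.B₃ * ε₁)) L N (k + 1) V U := by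
  intro k ε₁ hε₁ hε₁a V hV
  obtain ⟨⟨U, -, -, hmin⟩, -, -⟩ := hT k ε₁ hε₁ hε₁a V hV
  exact ⟨U, hmin⟩

/-- **★★ THEOREM 1 VERBATIM, INCLUDING ITS LAST SENTENCE, GIVES THEOREM 1 AT CONSTANTS WITH `M(e) ≥ 7∕2`**: from r2's `Thm1PrintedExact R₁M₁` (`M(ε₁) = R₁M₁(a₁∕ε₁)`) at the
class carriers `k ↦ torusVPCls d L N G (k+1)` and `7∕2 ≤ R₁M₁` (print: `R₁`, `M₁` of (1) p. 277, `M₁` «sufficiently large»): ONE block of constants `C` (`C.Mfun e = R₁M₁(a₁∕e)`,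
hence `≥ R₁M₁ ≥ 7∕2` on `0 < e ≤ a₁`) with `Thm1At C` at every class carrier. [cite: Balaban1985Variational, Thm 1 p.279, (1) p.277] [folklore] -/
theorem exists_consts_thm1At_of_thm1PrintedExact_torusVPCls {R₁M₁ : ℝ} (hRM : 7 / 2 ≤ R₁M₁)
    (hT : Thm1PrintedExact R₁M₁ (fun k : ℕ => torusVPCls d L N G (k + 1))) :
    ∃ C : B11Thm1.Consts, (∀ e : ℝ, 0 < e → e ≤ C.a₁ → 7 / 2 ≤ C.Mfun e) ∧ ∀ k : ℕ, Thm1At C (torusVPCls d L N G (k + 1)) := by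
  obtain ⟨a₀, a₁, B₃, B₄, ha₀, ha₁, hB₃, hB₄, hBa, H⟩ := hT
  have hRM0 : 0 < R₁M₁ := lt_of_lt_of_le (by norm_num) hRM
  refine ⟨⟨a₀, a₁, B₃, B₄, fun e => R₁M₁ * (a₁ / e), ha₀, ha₁, hB₃, hB₄, hBa, fun e he => by positivity⟩, ?_, ?_⟩
  · intro e he hea
    have h1 : 1 ≤ a₁ / e := by rw [le_div_iff₀ he]; simpa using hea
    calc (7 / 2 : ℝ) ≤ R₁M₁ * 1 := by simpa using hRM
      _ ≤ R₁M₁ * (a₁ / e) := mul_le_mul_of_nonneg_left h1 hRM0.le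
  · intro k ε₁ hε₁ hε₁a V hV
    exact H k ε₁ hε₁ hε₁a V hV

/-- **★★ THE SLOT KEY (T9ˢ) ∧ (T8) FROM THEOREM 1 VERBATIM** at the class carriers (`7∕2 ≤ R₁M₁`): §2's two projections at the constants of
`exists_consts_thm1At_of_thm1PrintedExact_torusVPCls`. [cite: Balaban1985Variational, Thm 1 (8)–(10) p.279] [folklore] -/
theorem exists_consts_slotKey_of_thm1PrintedExact_torusVPCls (hL : 1 ≤ L) {R₁M₁ : ℝ} (hRM : 7 / 2 ≤ R₁M₁)
    (hT : Thm1PrintedExact R₁M₁ (fun k : ℕ => torusVPCls d L N G (k + 1))) :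
    ∃ C : B11Thm1.Consts, (∀ e : ℝ, 0 < e → e ≤ C.a₁ → 7 / 2 ≤ C.Mfun e) ∧
      (∀ (k : ℕ) (ε₁ : ℝ), 0 < ε₁ → ε₁ ≤ C.a₁ → ∀ (V U : Site d → Fin d → (Matrix n n ℂ)ˣ), V ∈ sfClass d L N ε₁ 0 →
        IsMinimiser d (sfClass d L N (C.B₃ * ε₁)) L N (k + 1) V U →
          ∀ x : Site d, Regularity (torusVP d L N G (k + 1)) C.B₃ C.B₄ ε₁ U (x, L ^ (k + 1) - 1 + L ^ (k + 1) + 2)) ∧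
      (∀ (k : ℕ) (ε₁ : ℝ), 0 < ε₁ → ε₁ ≤ C.a₁ → ∀ V : Site d → Fin d → (Matrix n n ℂ)ˣ, V ∈ sfClass d L N ε₁ 0 →
        ∃ U : Site d → Fin d → (Matrix n n ℂ)ˣ, IsMinimiser d (sfClass d L N (C.B₃ * ε₁)) L N (k + 1) V U) := by
  obtain ⟨C, hM, hT'⟩ := exists_consts_thm1At_of_thm1PrintedExact_torusVPCls hRM hT
  exact ⟨C, hM, reg910Slot_of_thm1At_torusVPCls hL C hM hT', exists8Min_of_thm1At_torusVPCls C hT'⟩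

end Carrier

/-! ## §3 ★★ Node N16's K3ᴬ v8 sentence from node N05's Σ-text and THEOREM 1 AS PRINTED at the (42)-torus class carrier -/

variable {N : ℕ} [NeZero N] {β : ℝ}

/-- **★★ `WitnessDialN16Free N β` FROM NODE N05's Σ-OBJECT AND THEOREM 1 AT THE CLASS CARRIERS** (`0 ≤ β ≤ 1`): per family, constants `C F` with `M(e) ≥ 7∕2` and
`∀ k, Thm1At (C F) (torusVPCls 4 F.L Nper (lipGauge 4 (Fin N)) (k+1))` — [Balaban1985Variational] Theorem 1 at B11's own averaging, at leaf-06's carrier cut to print's cube class,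
local-gauge shape `lipGauge` — feed module 63 §1's producer through §2's slot key.  NO transfer, NO node-N07 record object displayed.
[cite: Balaban1985RegularSpaces, Thm 4 p.88, Prop. 3 p.87] [cite: Balaban1985Variational, Thm 1 (8)–(10) p.279] [folklore] -/
theorem witnessDialN16Free_of_n05UniformP_thm1At_torusVPCls (hβ0 : 0 ≤ β) (hβ1 : β ≤ 1)
    (hN05 : ∀ F : T4Family, letI : CStarAlgebra (Matrix (Fin N) (Fin N) ℂ) := B10Eq29TubeLine.cstarAlgebraMatrix N
      ∃ (Mκ Rκ : ℕ) (len : Site 4 → ℝ), (∀ v : Site 4, 0 < len v → 1 ≤ len v) ∧ (∀ μ : Fin 4, len (e μ) = 1) ∧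
      ∃ (inp : B8.B9Inputs) (B₀β B₈ c₄ c₃ : ℝ), inp.B₀ ≤ B₈ ∧ 0 < c₄ ∧ 0 < c₃ ∧
        ∀ (ν : {k : ℕ // 1 ≤ k}) (a : IdxB8SubDPerκ (stage3OfFamilyMat F N) (ne3NperOfRecord₁₁ F 0 0 * F.L ^ ν.1) Mκ Rκ),
          B8.Thm4Body c₄ (5 * ((4 : ℕ) : ℝ) * F.L * B₈)
            (fun _ : Unit => (zdGF3HP₂Per (Matrix (Fin N) (Fin N) ℂ) F.L β len a.toZdIdx (ne3NperOfRecord₁₁ F 0 0 * F.L ^ ν.1)).toGFData) ∧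
          B8.Prop3Body c₃ 4 (F.L : ℝ) (2097152 * (((4 : ℕ) : ℝ) + 1) ^ 2 * (F.L : ℝ) ^ 2) inp B₀β
            (fun _ : Unit => (zdGF3HP₂Per (Matrix (Fin N) (Fin N) ℂ) F.L β len a.toZdIdx (ne3NperOfRecord₁₁ F 0 0 * F.L ^ ν.1)).toGFData2))
    (hT : ∀ F : T4Family, ∃ C : B11Thm1.Consts, (∀ e : ℝ, 0 < e → e ≤ C.a₁ → 7 / 2 ≤ C.Mfun e) ∧
      ∀ k : ℕ, Thm1At C (torusVPCls 4 F.L (ne3NperOfRecord₁₁ F 0 0) (lipGauge 4 (Fin N)) (k + 1))) :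
    WitnessDialN16Free N β := by
  choose C hM hTC using hT
  exact witnessDialN16Free_of_n05UniformP_reg910Slot hβ0 hβ1 hN05 (G := fun _ => lipGauge 4 (Fin N)) (fun _ => radiiMono_lipGauge')
    (fun _ U x K α₀ α₁ α₂ hK hGU => interface_lipGauge' U x K α₀ α₁ α₂ hK hGU) C
    (fun F => reg910Slot_of_thm1At_torusVPCls (le_of_lt F.hL.2) (C F) (hM F) (hTC F))

/-- **★★★ `WitnessDialN16Free N β` FROM NODE N05's Σ-OBJECT AND [Balaban1985Variational] THEOREM 1 VERBATIM** (r2's `Thm1PrintedExact R₁M₁`, last sentence included, `7∕2 ≤ R₁M₁`)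
READ AT THE (42)-TORUS CLASS CARRIERS `k ↦ torusVPCls 4 F.L Nper (lipGauge 4 (Fin N)) (k+1)` of every family (`0 ≤ β ≤ 1`).  Node N16's ENTIRE K3ᴬ v8 stub-1 share displays:
node N05's Σ-text (p681888's conclusion) and THEOREM 1 AS PRINTED at a tree carrier — nothing of node N07's record, no transfer.
[cite: Balaban1985RegularSpaces, Thm 4 p.88, Prop. 3 p.87] [cite: Balaban1985Variational, Thm 1 p.279, (1) p.277] [folklore] -/
theorem witnessDialN16Free_of_n05UniformP_thm1PrintedExact (hβ0 : 0 ≤ β) (hβ1 : β ≤ 1)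
    (hN05 : ∀ F : T4Family, letI : CStarAlgebra (Matrix (Fin N) (Fin N) ℂ) := B10Eq29TubeLine.cstarAlgebraMatrix N
      ∃ (Mκ Rκ : ℕ) (len : Site 4 → ℝ), (∀ v : Site 4, 0 < len v → 1 ≤ len v) ∧ (∀ μ : Fin 4, len (e μ) = 1) ∧
      ∃ (inp : B8.B9Inputs) (B₀β B₈ c₄ c₃ : ℝ), inp.B₀ ≤ B₈ ∧ 0 < c₄ ∧ 0 < c₃ ∧
        ∀ (ν : {k : ℕ // 1 ≤ k}) (a : IdxB8SubDPerκ (stage3OfFamilyMat F N) (ne3NperOfRecord₁₁ F 0 0 * F.L ^ ν.1) Mκ Rκ),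
          B8.Thm4Body c₄ (5 * ((4 : ℕ) : ℝ) * F.L * B₈)
            (fun _ : Unit => (zdGF3HP₂Per (Matrix (Fin N) (Fin N) ℂ) F.L β len a.toZdIdx (ne3NperOfRecord₁₁ F 0 0 * F.L ^ ν.1)).toGFData) ∧
          B8.Prop3Body c₃ 4 (F.L : ℝ) (2097152 * (((4 : ℕ) : ℝ) + 1) ^ 2 * (F.L : ℝ) ^ 2) inp B₀β
            (fun _ : Unit => (zdGF3HP₂Per (Matrix (Fin N) (Fin N) ℂ) F.L β len a.toZdIdx (ne3NperOfRecord₁₁ F 0 0 * F.L ^ ν.1)).toGFData2))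
    {R₁M₁ : ℝ} (hRM : 7 / 2 ≤ R₁M₁)
    (hT : ∀ F : T4Family, Thm1PrintedExact R₁M₁ (fun k : ℕ => torusVPCls 4 F.L (ne3NperOfRecord₁₁ F 0 0) (lipGauge 4 (Fin N)) (k + 1))) :
    WitnessDialN16Free N β :=
  witnessDialN16Free_of_n05UniformP_thm1At_torusVPCls hβ0 hβ1 hN05 fun F => exists_consts_thm1At_of_thm1PrintedExact_torusVPCls hRM (hT F)

/-- **★★ THE REGISTERED K3ᴬ v8 STUB-1 TEXT WITH NODE N16 PAID FROM NODE N05's Σ-TEXT AND THEOREM 1 VERBATIM AT THE CLASS CARRIERS** (`N = 2`; `0 ≤ β ≤ 1` from the window):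
module 65 §4's `stub1Text_of_witnessFree` ∘ the ★★★ producer.  (ii) the v4-guarded reading and (iii) the K4 face at its NE3-erased reading are the OTHER lanes'; NOT a proof of
the stub. [cite: Balaban1985RegularSpaces, Thm 4 p.88, Prop. 3 p.87] [cite: Balaban1985Variational, Thm 1 p.279] [folklore] -/
theorem stub1Text_of_n05UniformP_thm1PrintedExact (hβ : 2 / 3 < β ∧ β < 1)
    (hN05 : ∀ F : T4Family, letI : CStarAlgebra (Matrix (Fin 2) (Fin 2) ℂ) := B10Eq29TubeLine.cstarAlgebraMatrix 2
      ∃ (Mκ Rκ : ℕ) (len : Site 4 → ℝ), (∀ v : Site 4, 0 < len v → 1 ≤ len v) ∧ (∀ μ : Fin 4, len (e μ) = 1) ∧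
      ∃ (inp : B8.B9Inputs) (B₀β B₈ c₄ c₃ : ℝ), inp.B₀ ≤ B₈ ∧ 0 < c₄ ∧ 0 < c₃ ∧
        ∀ (ν : {k : ℕ // 1 ≤ k}) (a : IdxB8SubDPerκ (stage3OfFamilyMat F 2) (ne3NperOfRecord₁₁ F 0 0 * F.L ^ ν.1) Mκ Rκ),
          B8.Thm4Body c₄ (5 * ((4 : ℕ) : ℝ) * F.L * B₈)
            (fun _ : Unit => (zdGF3HP₂Per (Matrix (Fin 2) (Fin 2) ℂ) F.L β len a.toZdIdx (ne3NperOfRecord₁₁ F 0 0 * F.L ^ ν.1)).toGFData) ∧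
          B8.Prop3Body c₃ 4 (F.L : ℝ) (2097152 * (((4 : ℕ) : ℝ) + 1) ^ 2 * (F.L : ℝ) ^ 2) inp B₀β
            (fun _ : Unit => (zdGF3HP₂Per (Matrix (Fin 2) (Fin 2) ℂ) F.L β len a.toZdIdx (ne3NperOfRecord₁₁ F 0 0 * F.L ^ ν.1)).toGFData2))
    {R₁M₁ : ℝ} (hRM : 7 / 2 ≤ R₁M₁)
    (hT : ∀ F : T4Family, Thm1PrintedExact R₁M₁ (fun k : ℕ => torusVPCls 4 F.L (ne3NperOfRecord₁₁ F 0 0) (lipGauge 4 (Fin 2)) (k + 1)))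
    {𝔯 : RateReading13AxP} {ksel : RunSel} {ℓ : LetterReading} (hGd : GuardedReading 𝔯 ksel ℓ) (hK : KeyedRatesHolderD4V β (rrOfRecord (eraseNE3Ax 𝔯) ksel)) :
    ∃ β : ℝ, 2 / 3 < β ∧ β < 1 ∧
      ∃ (𝔯 : RateReading13AxP) (ksel : RunSel) (ℓ : LetterReading) (ℓ₃ : T4Family → Node00.NE3Letters₁₁) (g B : T4Family → ℝ),
        GuardedReadingN16 𝔯 ksel ℓ ℓ₃ g B ∧ KeyedRatesHolderD4V β (rrOfRecord 𝔯 ksel) :=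
  stub1Text_of_witnessFree hβ
    (witnessDialN16Free_of_n05UniformP_thm1PrintedExact (le_trans (by norm_num) hβ.1.le) hβ.2.le hN05 hRM hT) hGd hK

/-! ## §4 The seam S-N16-1 dissolved by name: Theorem 1 at the class carrier PROVES dag-n16-w1's transfer -/

/-- **THEOREM 1 AT THE (42)-TORUS CLASS CARRIERS PROVES THE LOCATED TRANSFER `Thm1AtTransfer04toSlot F N ζ B₀`** for EVERY residual letter `ζ` and every `B₀ ≥ C.B₃`: the
transfer's CONSEQUENT (`∃ C', C'.B₃ ≤ B₀ ∧ (T9ˢ)(lipGauge, C') ∧ (T8)(C')`) holds outright by §2, so the implication holds regardless of its antecedent (Thm 1 at NODE 00's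
(0.4)-objects).  Hence S-N16-1's displayed `Prop` is a COROLLARY of [Balaban1985Variational] Theorem 1 read at B11's own averaging on print's cube class — the seam's content is
«Thm 1 at `torusVPCls`», a printed theorem at a dictionary instance. [cite: Balaban1985Variational, Thm 1 (8)–(10) p.279] [folklore] -/
theorem thm1AtTransfer04toSlot_of_thm1At_torusVPCls (F : T4Family) (ζ : ResidZ F N) (C : B11Thm1.Consts)
    (hM : ∀ e : ℝ, 0 < e → e ≤ C.a₁ → 7 / 2 ≤ C.Mfun e)
    (hT : ∀ k : ℕ, Thm1At C (torusVPCls 4 F.L (ne3NperOfRecord₁₁ F 0 0) (lipGauge 4 (Fin N)) (k + 1))) {B₀ : ℝ} (hB : C.B₃ ≤ B₀) :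
    Thm1AtTransfer04toSlot F N ζ B₀ :=
  fun _ => ⟨C, hB, reg910Slot_of_thm1At_torusVPCls (le_of_lt F.hL.2) C hM hT, exists8Min_of_thm1At_torusVPCls C hT⟩

/-- … and from THEOREM 1 VERBATIM (`Thm1PrintedExact R₁M₁`, `7∕2 ≤ R₁M₁`) at the class carriers: the transfer at SOME `B₀` (namely the printed `B₃`) for every `ζ`, so module 67's
displayed `h07` pair «N07 slot ∧ transfer» reduces to «N07 slot ∧ Thm 1 at `torusVPCls`» — and module 67's producers no longer need N07's slot at all (§3).
[cite: Balaban1985Variational, Thm 1 p.279] [folklore] -/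
theorem exists_thm1AtTransfer04toSlot_of_thm1PrintedExact (F : T4Family) (ζ : ResidZ F N) {R₁M₁ : ℝ} (hRM : 7 / 2 ≤ R₁M₁)
    (hT : Thm1PrintedExact R₁M₁ (fun k : ℕ => torusVPCls 4 F.L (ne3NperOfRecord₁₁ F 0 0) (lipGauge 4 (Fin N)) (k + 1))) :
    ∃ B₀ : ℝ, Thm1AtTransfer04toSlot F N ζ B₀ := by
  obtain ⟨C, hM, hT'⟩ := exists_consts_thm1At_of_thm1PrintedExact_torusVPCls hRM hT
  exact ⟨C.B₃, thm1AtTransfer04toSlot_of_thm1At_torusVPCls F ζ C hM hT' le_rfl⟩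

/-! ## §5 v1.1 EDITION (append-only; referee ref-B g50 READ-1081 typing row (ε)) — the printed ceiling letter `R₁M₁` PER FAMILY

Print's `R₁`, `M₁` ([Balaban1985Variational] (1) p. 277, «M₁ sufficiently large») depend on `(d, L)`, and `L = F.L` varies with the family; `Thm1PrintedExact R₁M₁` is NOT monotone in
`R₁M₁` (a larger ceiling asks (9)–(10) on LARGER cubes).  §3's `hT` quantified ONE `R₁M₁` outside `∀ F` — more than print.  The forms below take `R₁M₁` INSIDE `∀ F` (one printed
number per family); the §2 lemmas are applied per family, so the proofs are unchanged.  These are the forms a re-pointed display (director-ym №574 (2)) should cite. -/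

/-- **★★★ `WitnessDialN16Free N β` FROM NODE N05's Σ-OBJECT AND THEOREM 1 VERBATIM, THE CEILING LETTER `R₁M₁ ≥ 7∕2` CHOSEN PER FAMILY** (`0 ≤ β ≤ 1`; v1.1, row (ε)):
`hT : ∀ F, ∃ R₁M₁, 7∕2 ≤ R₁M₁ ∧ Thm1PrintedExact R₁M₁ (k ↦ torusVPCls 4 F.L Nper (lipGauge 4 (Fin N)) (k+1))`.
[cite: Balaban1985RegularSpaces, Thm 4 p.88, Prop. 3 p.87] [cite: Balaban1985Variational, Thm 1 p.279, (1) p.277] [folklore] -/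
theorem witnessDialN16Free_of_n05UniformP_thm1PrintedExactL (hβ0 : 0 ≤ β) (hβ1 : β ≤ 1)
    (hN05 : ∀ F : T4Family, letI : CStarAlgebra (Matrix (Fin N) (Fin N) ℂ) := B10Eq29TubeLine.cstarAlgebraMatrix N
      ∃ (Mκ Rκ : ℕ) (len : Site 4 → ℝ), (∀ v : Site 4, 0 < len v → 1 ≤ len v) ∧ (∀ μ : Fin 4, len (e μ) = 1) ∧
      ∃ (inp : B8.B9Inputs) (B₀β B₈ c₄ c₃ : ℝ), inp.B₀ ≤ B₈ ∧ 0 < c₄ ∧ 0 < c₃ ∧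
        ∀ (ν : {k : ℕ // 1 ≤ k}) (a : IdxB8SubDPerκ (stage3OfFamilyMat F N) (ne3NperOfRecord₁₁ F 0 0 * F.L ^ ν.1) Mκ Rκ),
          B8.Thm4Body c₄ (5 * ((4 : ℕ) : ℝ) * F.L * B₈)
            (fun _ : Unit => (zdGF3HP₂Per (Matrix (Fin N) (Fin N) ℂ) F.L β len a.toZdIdx (ne3NperOfRecord₁₁ F 0 0 * F.L ^ ν.1)).toGFData) ∧
          B8.Prop3Body c₃ 4 (F.L : ℝ) (2097152 * (((4 : ℕ) : ℝ) + 1) ^ 2 * (F.L : ℝ) ^ 2) inp B₀β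
            (fun _ : Unit => (zdGF3HP₂Per (Matrix (Fin N) (Fin N) ℂ) F.L β len a.toZdIdx (ne3NperOfRecord₁₁ F 0 0 * F.L ^ ν.1)).toGFData2))
    (hT : ∀ F : T4Family, ∃ R₁M₁ : ℝ, 7 / 2 ≤ R₁M₁ ∧
      Thm1PrintedExact R₁M₁ (fun k : ℕ => torusVPCls 4 F.L (ne3NperOfRecord₁₁ F 0 0) (lipGauge 4 (Fin N)) (k + 1))) :
    WitnessDialN16Free N β :=
  witnessDialN16Free_of_n05UniformP_thm1At_torusVPCls hβ0 hβ1 hN05 fun F => by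
    obtain ⟨R₁M₁, hRM, h⟩ := hT F
    exact exists_consts_thm1At_of_thm1PrintedExact_torusVPCls hRM h

/-- **★★ THE REGISTERED K3ᴬ v8 STUB-1 TEXT WITH NODE N16 PAID, CEILING LETTER PER FAMILY** (`N = 2`; v1.1, row (ε); module 65 §4 ∘ the ★★★ producer above).
[cite: Balaban1985RegularSpaces, Thm 4 p.88, Prop. 3 p.87] [cite: Balaban1985Variational, Thm 1 p.279] [folklore] -/
theorem stub1Text_of_n05UniformP_thm1PrintedExactL (hβ : 2 / 3 < β ∧ β < 1)
    (hN05 : ∀ F : T4Family, letI : CStarAlgebra (Matrix (Fin 2) (Fin 2) ℂ) := B10Eq29TubeLine.cstarAlgebraMatrix 2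
      ∃ (Mκ Rκ : ℕ) (len : Site 4 → ℝ), (∀ v : Site 4, 0 < len v → 1 ≤ len v) ∧ (∀ μ : Fin 4, len (e μ) = 1) ∧
      ∃ (inp : B8.B9Inputs) (B₀β B₈ c₄ c₃ : ℝ), inp.B₀ ≤ B₈ ∧ 0 < c₄ ∧ 0 < c₃ ∧
        ∀ (ν : {k : ℕ // 1 ≤ k}) (a : IdxB8SubDPerκ (stage3OfFamilyMat F 2) (ne3NperOfRecord₁₁ F 0 0 * F.L ^ ν.1) Mκ Rκ),
          B8.Thm4Body c₄ (5 * ((4 : ℕ) : ℝ) * F.L * B₈)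
            (fun _ : Unit => (zdGF3HP₂Per (Matrix (Fin 2) (Fin 2) ℂ) F.L β len a.toZdIdx (ne3NperOfRecord₁₁ F 0 0 * F.L ^ ν.1)).toGFData) ∧
          B8.Prop3Body c₃ 4 (F.L : ℝ) (2097152 * (((4 : ℕ) : ℝ) + 1) ^ 2 * (F.L : ℝ) ^ 2) inp B₀β
            (fun _ : Unit => (zdGF3HP₂Per (Matrix (Fin 2) (Fin 2) ℂ) F.L β len a.toZdIdx (ne3NperOfRecord₁₁ F 0 0 * F.L ^ ν.1)).toGFData2))
    (hT : ∀ F : T4Family, ∃ R₁M₁ : ℝ, 7 / 2 ≤ R₁M₁ ∧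
      Thm1PrintedExact R₁M₁ (fun k : ℕ => torusVPCls 4 F.L (ne3NperOfRecord₁₁ F 0 0) (lipGauge 4 (Fin 2)) (k + 1)))
    {𝔯 : RateReading13AxP} {ksel : RunSel} {ℓ : LetterReading} (hGd : GuardedReading 𝔯 ksel ℓ) (hK : KeyedRatesHolderD4V β (rrOfRecord (eraseNE3Ax 𝔯) ksel)) :
    ∃ β : ℝ, 2 / 3 < β ∧ β < 1 ∧
      ∃ (𝔯 : RateReading13AxP) (ksel : RunSel) (ℓ : LetterReading) (ℓ₃ : T4Family → Node00.NE3Letters₁₁) (g B : T4Family → ℝ),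
        GuardedReadingN16 𝔯 ksel ℓ ℓ₃ g B ∧ KeyedRatesHolderD4V β (rrOfRecord 𝔯 ksel) :=
  stub1Text_of_witnessFree hβ
    (witnessDialN16Free_of_n05UniformP_thm1PrintedExactL (le_trans (by norm_num) hβ.1.le) hβ.2.le hN05 hT) hGd hK

end

end Summit.QuantumFields.YangMills.BalabanUVNodes.N16SlotKeyOfThm1PrintClass
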